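import Summits.CriticalPhenomena.PercolationContinuityZ3.Theorems.PercNearOneGluingAdditiveGluingSandwichBase
import HarnessLib

/-!
# Sandwich BHK inequality — the induction (crux `PercNearOneGluing.AdditiveGluing`,
stmt-CriticalPhenomena-4576; siege k18, file 3/5, registered stub `stub_sandwichCore_k18`)

`SandwichBHK.core`: for percolation restricted to `U`, `o, a ∈ U`, `a ≠ b`, a family `R` of
vertex sets avoiding `a`, and `S, T ⊆ U`,
`P(a↔b, E_S, a↮S) · P(a↮T) ≤ P(a↔b, a↮S∩T) · P(E_{S∪T}, a↮S∪T)`,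
`E_X = {o ↔ X} ∪ ({o ↮ X} ∩ {C(o) ∈ R})`.  With `S = T = {c}` this is the **sandwich
inequality** (file 4/5): given `{a ↮ c}`, `{a ↔ b}` is negatively correlated with every
`C(o)`-determined event sandwiched between `{o ↔ c}` and `{o ↮ a}` — van den Berg–Häggström–Kahn's
Theorem 1.4 is `E = {o ↔ c}` and their Theorem 1.3 is `E = {o ↮ a}`.
Proof = BHK's proof of their Theorem 1.1 (strong induction on `U`; conditioning on the open
layer of `Z = S ∩ T` — an open path to `S` either enters `Z` through the layer or avoids `Z`, so
the sandwich event localises to `G[U ∖ Z]` exactly like `{a ↮ S}`; Ahlswede–Daykin four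
functions theorem, the `E`-factor riding with the union and the `{a↔b, a↮·}`-factor with the
intersection), with the base case of file 2/5 and BHK's Theorem 1.1 itself (`BHK2006.core`) in
the degenerate case `o ∈ Z`.
-/

noncomputable section

open Literature.Probability.Percolation Literature.Probability.Percolation.BHK2006 DecisionTree

namespace Summit.CriticalPhenomena.PercolationContinuityZ3.Theorems.SandwichBHK

open scoped Classical

/-! Local notations (no new definitions): `ℙ[w] A` the weight-sum probability of the event `A`;
`rF[U, a, b]` the connection event `{a ↔ b}` of `G[U]`; `rV[U, S, ω]` the finite set of vertices of
`G[U]` reachable from the source set `S`; `rE[U, o, R, X]` the **sandwich event**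
`{o ↔ X} ∪ ({o ↮ X} ∩ {C(o) ∈ R})` for a family `R` of vertex sets; `rB[U, Y]` the moat event
(no open edge between `Y` and `U ∖ Y`, i.e. BHK's random set of `Y` is empty). -/
local notation3 "ℙ[" w "] " A:max => ∑ ω, weight w ω * ind A ω
local notation3 "rF[" U ", " a ", " b "]" =>
  {ω : Set (Sym2 _) | (openGraph (ω ∩ edgesIn U)).Reachable a b}
local notation3 "rV[" U ", " S ", " ω "]" =>
  Finset.univ.filter (fun v => ∃ s ∈ (S : Set _), (openGraph (ω ∩ edgesIn U)).Reachable s v)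
local notation3 "rE[" U ", " o ", " R ", " X "]" =>
  {ω : Set (Sym2 _) | (∃ x ∈ (X : Set _), (openGraph (ω ∩ edgesIn U)).Reachable o x) ∨
    (ω ∈ rD U o X ∧ ∃ W ∈ (R : Set (Finset _)), ∀ v, v ∈ W ↔ (openGraph (ω ∩ edgesIn U)).Reachable o v)}
local notation3 "rB[" U ", " Y "]" => {ω : Set (Sym2 _) | ∀ n, n ∉ rS U Y ω}

section Core

variable {V : Type*} [Fintype V] {w : Sym2 V → ℝ}

/-! #### Localisation to `G[U ∖ Z]` given the open layer of `Z` (BHK's identity (6)) -/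

omit [Fintype V] in
/-- BHK's (6) for the connection event: on `{a ↮ (W ∖ Z) ∪ L}` of `G[U ∖ Z]` (`L` the open layer
of `Z`), `{a ↔ b in G[U]} = {a ↔ b in G[U ∖ Z]}`. [cite: VandenbergHaggstromKahn2005, §1 p. 4, identity (6)] -/
theorem mem_rF_iff_restrict {U Z : Finset V} {a b : V} (haZ : a ∉ Z) {X : Set V} {ω : Set (Sym2 V)}
    (hD : ω ∈ rD (U \ Z) a (X ∪ rS U Z ω)) : ω ∈ rF[U, a, b] ↔ ω ∈ rF[(U \ Z), a, b] := by
  constructor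
  · intro h
    exact (reach_restrict (U := U) (Z := Z) haZ (fun n hn => hD n (Or.inr hn)) h).2
  · exact fun h => rF_mono_U Finset.sdiff_subset a b h

/-- On `{o ↮ (W ∖ Z) ∪ L in G[U ∖ Z]}` the cluster of `o` in `G[U]` is its cluster in `G[U ∖ Z]`.
[cite: VandenbergHaggstromKahn2005, §1 p. 4, identity (6)] -/
theorem rV_eq_restrict {U Z : Finset V} {o : V} (hoZ : o ∉ Z) {X : Set V} {ω : Set (Sym2 V)}
    (hD : ω ∈ rD (U \ Z) o (X ∪ rS U Z ω)) : rV[U, {o}, ω] = rV[(U \ Z), {o}, ω] := by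
  ext v
  rw [mem_rV_singleton, mem_rV_singleton]
  constructor
  · intro h
    exact (reach_restrict (U := U) (Z := Z) hoZ (fun n hn => hD n (Or.inr hn)) h).2
  · exact fun h => h.mono (openGraph_le (Set.inter_subset_inter_right _ (edgesIn_mono Finset.sdiff_subset)))

/-- **BHK's (6) for the sandwich event**: for `Z ⊆ W`, `o ∉ Z`,
`E_W(G[U]) = E_{(W ∖ Z) ∪ L}(G[U ∖ Z])` with `L` the open layer of `Z`. [new] -/
theorem mem_rE_iff_restrict {U Z : Finset V} (hZU : Z ⊆ U) {o : V} (hoZ : o ∉ Z)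
    (R : Set (Finset V)) {W : Set V} (hZW : (↑Z : Set V) ⊆ W) (ω : Set (Sym2 V)) :
    ω ∈ rE[U, o, R, W] ↔ ω ∈ rE[(U \ Z), o, R, ((W \ ↑Z) ∪ rS U Z ω)] := by
  have hD := mem_rD_iff_restrict hZU hoZ hZW ω (s := o)
  have hO : (∃ x ∈ W, (openGraph (ω ∩ edgesIn U)).Reachable o x) ↔
      ∃ x ∈ (W \ ↑Z) ∪ rS U Z ω, (openGraph (ω ∩ edgesIn (U \ Z))).Reachable o x := by
    have h1 : (∃ x ∈ W, (openGraph (ω ∩ edgesIn U)).Reachable o x) ↔ ω ∉ rD U o W := by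
      simp only [rD, Set.mem_setOf_eq, not_forall, not_not, exists_prop]
    have h2 : (∃ x ∈ (W \ ↑Z) ∪ rS U Z ω, (openGraph (ω ∩ edgesIn (U \ Z))).Reachable o x) ↔
        ω ∉ rD (U \ Z) o ((W \ ↑Z) ∪ rS U Z ω) := by
      simp only [rD, Set.mem_setOf_eq, not_forall, not_not, exists_prop]
    rw [h1, h2, hD]
  simp only [Set.mem_setOf_eq]
  refine or_congr hO ⟨fun ⟨h1, h2⟩ => ⟨hD.1 h1, ?_⟩, fun ⟨h1, h2⟩ => ⟨hD.2 h1, ?_⟩⟩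
  · rwa [exists_iff_rV_mem, ← rV_eq_restrict hoZ (hD.1 h1), ← exists_iff_rV_mem]
  · rwa [exists_iff_rV_mem, rV_eq_restrict hoZ h1, ← exists_iff_rV_mem]

/-- **Conditioning on the open layer** (BHK's (6), summed; generic form of `BHK2006.step_sum`):
if `h(ω) = Ψ_{L(ω)}(ω ∖ meeting Z)` with each `Ψ_L` a function of the edges off `Z`, then
`E[h] = Σ_ω weight(ω) · E[Ψ_{L(ω)}]`. [cite: VandenbergHaggstromKahn2005, §1 p. 4, display before (5)] -/
theorem step_sum_gen {U Z : Finset V} (w : Sym2 V → ℝ) (hm : ∑ ω, weight w ω = 1)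
    (h : Set (Sym2 V) → ℝ) (Ψ : Set V → Set (Sym2 V) → ℝ)
    (h1 : ∀ ω, h ω = Ψ (rS U Z ω) (ω \ meeting Z)) (h2 : ∀ L ω, Ψ L (ω \ meeting Z) = Ψ L ω) :
    ∑ ω, weight w ω * h ω = ∑ ω, weight w ω * ∑ ω', weight w ω' * Ψ (rS U Z ω) ω' := by
  set A := meeting Z with hA
  set Φ : Set (Sym2 V) → Set (Sym2 V) → ℝ := fun ζ η => Ψ (rS U Z ζ) η with hΦ
  have e1 : ∀ ω, h ω = Φ (ω ∩ A) (ω \ A) := fun ω => by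
    simp only [hΦ, hA, rS_inter_meeting]; exact h1 ω
  have e2 : ∀ ω ω', Φ (ω ∩ A) (ω' \ A) = Ψ (rS U Z ω) ω' := fun ω ω' => by
    simp only [hΦ, hA, rS_inter_meeting]
    exact h2 _ _
  calc ∑ ω, weight w ω * h ω = (∑ ω, weight w ω) * ∑ ω, weight w ω * Φ (ω ∩ A) (ω \ A) := by
        rw [hm, one_mul]; simp_rw [e1]
    _ = ∑ ω, weight w ω * ∑ ω', weight w ω' * Φ (ω ∩ A) (ω' \ A) := blockFubini w A Φ
    _ = _ := by simp_rw [e2]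

/-! #### The monotone cluster function `1{b ∈ V(C_a)}` (for the case `o ∈ Z`) -/

/-- `{a ↔ b}` as an increasing function of BHK's edge cluster `C_a`: `b` is an endpoint of an edge
of `C_a` (for `a ≠ b`). [folklore] -/
theorem ind_rF_eq_clusterFn {U : Finset V} {a b : V} (hab : a ≠ b) (ω : Set (Sym2 V)) :
    ind (rF[U, a, b]) ω = if ∃ e ∈ rC U a ω, b ∈ e then 1 else 0 := by
  by_cases h : ω ∈ rF[U, a, b]
  · rw [ind_of_mem h, if_pos]
    have h' := h
    rw [Set.mem_setOf_eq, SimpleGraph.reachable_iff_reflTransGen] at h'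
    rcases Relation.ReflTransGen.cases_tail h' with hba | ⟨c, hac, hcb⟩
    · exact absurd hba.symm hab
    · obtain ⟨hω, hU, hne⟩ := adj_iff.1 hcb
      refine ⟨s(c, b), ⟨⟨hω, mem_edgesIn_mk.2 hU⟩, ?_, ?_⟩, Sym2.mem_mk_right c b⟩
      · rw [Sym2.mk_isDiag_iff]; exact hne
      · intro v hv
        rcases Sym2.mem_iff.1 hv with rfl | rfl
        · exact (SimpleGraph.reachable_iff_reflTransGen _ _).2 hac
        · exact h
  · rw [ind_of_not_mem h, if_neg]
    rintro ⟨e, he, hbe⟩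
    exact h (he.2.2 b hbe)

/-! #### The sandwich induction -/

/-- **Sandwich BHK inequality, two-set form, for percolation restricted to `U`.**
For `o, a ∈ U`, `a ≠ b`, a family `R` of vertex sets avoiding `a`, and `S, T ⊆ U`:
`P(a↔b, E_S, a↮S) · P(a↮T) ≤ P(a↔b, a↮S∩T) · P(E_{S∪T}, a↮S∪T)`,
where `E_X = {o ↔ X} ∪ ({o ↮ X} ∩ {C(o) ∈ R})`. Proof by strong induction on `U` following
van den Berg–Häggström–Kahn's proof of their Theorem 1.1: if `S ∩ T = ∅` this is `base`; if
`o ∈ S ∩ T` the sandwich events are trivial and this is BHK's Theorem 1.1 (`BHK2006.core`);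
otherwise condition on the open layer of `Z = S ∩ T` and apply the four functions theorem with
the induction hypothesis on `U ∖ Z`. [new] -/
theorem core (hw0 : ∀ e, 0 ≤ w e) (hw1 : ∀ e, w e ≤ 1) (hm : ∑ ω, weight w ω = 1) (U : Finset V) :
    ∀ (o a b : V), o ∈ U → a ∈ U → a ≠ b → ∀ (R : Set (Finset V)), (∀ W ∈ R, a ∉ W) →
    ∀ (S T : Set V), S ⊆ ↑U → T ⊆ ↑U →
    ℙ[w] (rF[U, a, b] ∩ rE[U, o, R, S] ∩ rD U a S) * ℙ[w] (rD U a T) ≤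
      ℙ[w] (rF[U, a, b] ∩ rD U a (S ∩ T)) * ℙ[w] (rE[U, o, R, (S ∪ T)] ∩ rD U a (S ∪ T)) := by
  induction U using Finset.strongInduction with
  | H U ih =>
  intro o a b hoU haU hab R hR S T hSU hTU
  have hRHS : 0 ≤ ℙ[w] (rF[U, a, b] ∩ rD U a (S ∩ T)) * ℙ[w] (rE[U, o, R, (S ∪ T)] ∩ rD U a (S ∪ T)) :=
    mul_nonneg (pr_nonneg hw0 hw1 _) (pr_nonneg hw0 hw1 _)
  -- trivial cases `a ∈ S`, `a ∈ T`
  by_cases haS : a ∈ S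
  · have h0 : rF[U, a, b] ∩ rE[U, o, R, S] ∩ rD U a S = ∅ := by
      rw [rD_eq_empty haS, Set.inter_empty]
    rw [h0, pr_empty, zero_mul]; exact hRHS
  by_cases haT : a ∈ T
  · rw [rD_eq_empty haT, pr_empty, mul_zero]; exact hRHS
  -- `Z := S ∩ T`
  set Z : Finset V := U.filter fun v => v ∈ S ∧ v ∈ T with hZ
  have hZU : Z ⊆ U := Finset.filter_subset _ _
  have hmemZ : ∀ v, v ∈ Z ↔ v ∈ S ∧ v ∈ T := fun v => by
    simp only [hZ, Finset.mem_filter, and_iff_right_iff_imp]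
    exact fun h => hSU h.1
  have haZ : a ∉ Z := fun h => haS ((hmemZ a).1 h).1
  rcases Z.eq_empty_or_nonempty with hZe | hZne
  · /- `S ∩ T = ∅`: the base inequality. -/
    have hST : rD U a (S ∩ T) = Set.univ := by
      refine Set.eq_univ_of_forall fun ω x hx _ => ?_
      have : x ∈ Z := (hmemZ x).2 hx
      rw [hZe] at this
      exact absurd this (Finset.notMem_empty x)
    rw [hST, Set.inter_univ]
    exact base hw0 hw1 hm hoU R hR hSU T
  by_cases hoZ : o ∈ Z
  · /- `o ∈ S ∩ T`: the sandwich events are sure; BHK's Theorem 1.1 with `B` trivial. -/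
    have hoS : o ∈ S := ((hmemZ o).1 hoZ).1
    have hE1 : rE[U, o, R, S] = Set.univ :=
      Set.eq_univ_of_forall fun ω => Or.inl ⟨o, hoS, SimpleGraph.Reachable.refl o⟩
    have hE2 : rE[U, o, R, (S ∪ T)] = Set.univ :=
      Set.eq_univ_of_forall fun ω => Or.inl ⟨o, Or.inl hoS, SimpleGraph.Reachable.refl o⟩
    rw [hE1, hE2, Set.inter_univ, Set.univ_inter]
    set FB : Set (Sym2 V) → ℝ := fun C => if ∃ e ∈ C, b ∈ e then 1 else 0 with hFB
    have hFBm : Monotone FB := by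
      intro C C' hCC'
      simp only [hFB]
      by_cases h : ∃ e ∈ C, b ∈ e
      · obtain ⟨e, he, hbe⟩ := h
        rw [if_pos ⟨e, he, hbe⟩, if_pos ⟨e, hCC' he, hbe⟩]
      · rw [if_neg h]; split_ifs <;> norm_num
    have hFB0 : ∀ C, 0 ≤ FB C := fun C => by simp only [hFB]; split_ifs <;> norm_num
    have key := BHK2006.core w hw0 hw1 hm U a haU S T hSU hTU FB (fun _ => (1 : ℝ)) hFBm
      monotone_const hFB0 (fun _ => zero_le_one)
    have c1 : ∀ X : Set V, ℙ[w] (rF[U, a, b] ∩ rD U a X) =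
        ∑ ω, weight w ω * (FB (rC U a ω) * ind (rD U a X) ω) := fun X =>
      Finset.sum_congr rfl fun ω _ => by rw [ind_inter, ind_rF_eq_clusterFn hab]
    have c2 : ℙ[w] (rD U a T) = ∑ ω, weight w ω * ((fun _ => (1 : ℝ)) (rC U a ω) * ind (rD U a T) ω) :=
      Finset.sum_congr rfl fun ω _ => by simp only [one_mul]
    have c3 : ∑ ω, weight w ω * (FB (rC U a ω) * (fun _ => (1 : ℝ)) (rC U a ω) *
        ind (rD U a (S ∩ T)) ω) = ℙ[w] (rF[U, a, b] ∩ rD U a (S ∩ T)) := by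
      rw [c1]; exact Finset.sum_congr rfl fun ω _ => by simp only [mul_one]
    rw [c1 S, c2, ← c3]
    exact key
  by_cases hbZ : b ∈ Z
  · have hbS : b ∈ S := ((hmemZ b).1 hbZ).1
    have h0 : rF[U, a, b] ∩ rE[U, o, R, S] ∩ rD U a S = ∅ :=
      Set.eq_empty_of_forall_notMem fun ω hω => hω.2 b hbS hω.1.1
    rw [h0, pr_empty, zero_mul]; exact hRHS
  /- main step: condition on the open layer of `Z` and apply the four functions theorem. -/
  have hss : U \ Z ⊂ U := Finset.sdiff_ssubset hZU hZne
  have hoU' : o ∈ U \ Z := Finset.mem_sdiff.2 ⟨hoU, hoZ⟩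
  have haU' : a ∈ U \ Z := Finset.mem_sdiff.2 ⟨haU, haZ⟩
  have hZS : (↑Z : Set V) ⊆ S := fun v hv => ((hmemZ v).1 hv).1
  have hZT : (↑Z : Set V) ⊆ T := fun v hv => ((hmemZ v).1 hv).2
  have hZST : (↑Z : Set V) ⊆ S ∩ T := fun v hv => (hmemZ v).1 hv
  have hZSuT : (↑Z : Set V) ⊆ S ∪ T := fun v hv => Or.inl (((hmemZ v).1 hv).1)
  set U' := U \ Z with hU'
  -- the four block expectations
  set Ψ₁ : Set V → ℝ := fun L =>
    ℙ[w] (rF[U', a, b] ∩ rE[U', o, R, (S \ ↑Z ∪ L)] ∩ rD U' a (S \ ↑Z ∪ L)) with hΨ₁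
  set Ψ₂ : Set V → ℝ := fun L => ℙ[w] (rD U' a (T \ ↑Z ∪ L)) with hΨ₂
  set Ψ₃ : Set V → ℝ := fun L => ℙ[w] (rF[U', a, b] ∩ rD U' a ((S ∩ T) \ ↑Z ∪ L)) with hΨ₃
  set Ψ₄ : Set V → ℝ := fun L =>
    ℙ[w] (rE[U', o, R, ((S ∪ T) \ ↑Z ∪ L)] ∩ rD U' a ((S ∪ T) \ ↑Z ∪ L)) with hΨ₄
  have e1 : ℙ[w] (rF[U, a, b] ∩ rE[U, o, R, S] ∩ rD U a S) = ∑ ω, weight w ω * Ψ₁ (rS U Z ω) := by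
    refine step_sum_gen w hm _ (fun L ω' => ind (rF[U', a, b] ∩ rE[U', o, R, (S \ ↑Z ∪ L)] ∩
      rD U' a (S \ ↑Z ∪ L)) ω') (fun ω => ?_) (fun L ω => ?_)
    · refine BystanderBHK.ind_congr ?_
      rw [Set.mem_inter_iff, Set.mem_inter_iff, Set.mem_inter_iff, Set.mem_inter_iff,
        mem_rF_diff_meeting, mem_rE_diff_meeting, mem_rD_diff_meeting]
      have hD := mem_rD_iff_restrict hZU haZ hZS ω (s := a)
      have hE := mem_rE_iff_restrict hZU hoZ R hZS ω
      constructor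
      · rintro ⟨⟨hF, hE'⟩, hD'⟩
        have hD'' := hD.1 hD'
        exact ⟨⟨(mem_rF_iff_restrict haZ hD'').1 hF, hE.1 hE'⟩, hD''⟩
      · rintro ⟨⟨hF, hE'⟩, hD'⟩
        exact ⟨⟨(mem_rF_iff_restrict haZ hD').2 hF, hE.2 hE'⟩, hD.2 hD'⟩
    · refine BystanderBHK.ind_congr ?_
      rw [Set.mem_inter_iff, Set.mem_inter_iff, Set.mem_inter_iff, Set.mem_inter_iff,
        mem_rF_diff_meeting, mem_rE_diff_meeting, mem_rD_diff_meeting]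
  have e2 : ℙ[w] (rD U a T) = ∑ ω, weight w ω * Ψ₂ (rS U Z ω) := by
    refine step_sum_gen w hm _ (fun L ω' => ind (rD U' a (T \ ↑Z ∪ L)) ω') (fun ω => ?_)
      (fun L ω => ?_)
    · refine BystanderBHK.ind_congr ?_
      rw [mem_rD_diff_meeting]
      exact mem_rD_iff_restrict hZU haZ hZT ω
    · exact BystanderBHK.ind_congr (mem_rD_diff_meeting U Z a _ ω)
  have e3 : ℙ[w] (rF[U, a, b] ∩ rD U a (S ∩ T)) = ∑ ω, weight w ω * Ψ₃ (rS U Z ω) := by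
    refine step_sum_gen w hm _ (fun L ω' => ind (rF[U', a, b] ∩ rD U' a ((S ∩ T) \ ↑Z ∪ L)) ω')
      (fun ω => ?_) (fun L ω => ?_)
    · refine BystanderBHK.ind_congr ?_
      rw [Set.mem_inter_iff, Set.mem_inter_iff, mem_rF_diff_meeting, mem_rD_diff_meeting]
      have hD := mem_rD_iff_restrict hZU haZ hZST ω (s := a)
      constructor
      · rintro ⟨hF, hD'⟩
        have hD'' := hD.1 hD'
        exact ⟨(mem_rF_iff_restrict haZ hD'').1 hF, hD''⟩
      · rintro ⟨hF, hD'⟩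
        exact ⟨(mem_rF_iff_restrict haZ hD').2 hF, hD.2 hD'⟩
    · refine BystanderBHK.ind_congr ?_
      rw [Set.mem_inter_iff, Set.mem_inter_iff, mem_rF_diff_meeting, mem_rD_diff_meeting]
  have e4 : ℙ[w] (rE[U, o, R, (S ∪ T)] ∩ rD U a (S ∪ T)) = ∑ ω, weight w ω * Ψ₄ (rS U Z ω) := by
    refine step_sum_gen w hm _ (fun L ω' => ind (rE[U', o, R, ((S ∪ T) \ ↑Z ∪ L)] ∩
      rD U' a ((S ∪ T) \ ↑Z ∪ L)) ω') (fun ω => ?_) (fun L ω => ?_)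
    · refine BystanderBHK.ind_congr ?_
      rw [Set.mem_inter_iff, Set.mem_inter_iff, mem_rE_diff_meeting, mem_rD_diff_meeting]
      exact and_congr (mem_rE_iff_restrict hZU hoZ R hZSuT ω) (mem_rD_iff_restrict hZU haZ hZSuT ω)
    · refine BystanderBHK.ind_congr ?_
      rw [Set.mem_inter_iff, Set.mem_inter_iff, mem_rE_diff_meeting, mem_rD_diff_meeting]
  rw [e1, e2, e3, e4]
  have hΨ0 : ∀ (i : Fin 4) L, 0 ≤ (![Ψ₁, Ψ₂, Ψ₃, Ψ₄] i) L := by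
    intro i L
    fin_cases i <;> exact pr_nonneg hw0 hw1 _
  refine four_functions_theorem_univ (fun ω => weight w ω * Ψ₁ (rS U Z ω))
    (fun ω => weight w ω * Ψ₂ (rS U Z ω)) (fun ω => weight w ω * Ψ₃ (rS U Z ω))
    (fun ω => weight w ω * Ψ₄ (rS U Z ω))
    (fun ω => mul_nonneg (weight_nonneg hw0 hw1 ω) (hΨ0 0 _))
    (fun ω => mul_nonneg (weight_nonneg hw0 hw1 ω) (hΨ0 1 _))
    (fun ω => mul_nonneg (weight_nonneg hw0 hw1 ω) (hΨ0 2 _))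
    (fun ω => mul_nonneg (weight_nonneg hw0 hw1 ω) (hΨ0 3 _)) fun α β => ?_
  -- the Ahlswede–Daykin hypothesis: weight lattice identity × induction hypothesis on `U ∖ Z`
  set Sa := rS U Z α with hSa
  set Sb := rS U Z β with hSb
  have hSaU : Sa ⊆ ↑(U \ Z) := rS_subset U Z α
  have hSbU : Sb ⊆ ↑(U \ Z) := rS_subset U Z β
  have hX1 : S \ ↑Z ∪ Sa ⊆ ↑(U \ Z) := Set.union_subset
    (fun v hv => by rw [Finset.coe_sdiff]; exact ⟨hSU hv.1, hv.2⟩) hSaU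
  have hY1 : T \ ↑Z ∪ Sb ⊆ ↑(U \ Z) := Set.union_subset
    (fun v hv => by rw [Finset.coe_sdiff]; exact ⟨hTU hv.1, hv.2⟩) hSbU
  have IH := ih (U \ Z) hss o a b hoU' haU' hab R hR (S \ ↑Z ∪ Sa) (T \ ↑Z ∪ Sb) hX1 hY1
  have hsub3 : (S ∩ T) \ ↑Z ∪ rS U Z (α ∩ β) ⊆ (S \ ↑Z ∪ Sa) ∩ (T \ ↑Z ∪ Sb) := by
    refine Set.union_subset (fun v hv => ⟨Or.inl ⟨hv.1.1, hv.2⟩, Or.inl ⟨hv.1.2, hv.2⟩⟩) ?_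
    exact fun v hv =>
      ⟨Or.inr (rS_inter_subset U Z α β hv).1, Or.inr (rS_inter_subset U Z α β hv).2⟩
  have hset4 : (S \ ↑Z ∪ Sa) ∪ (T \ ↑Z ∪ Sb) = (S ∪ T) \ ↑Z ∪ rS U Z (α ∪ β) := by
    rw [rS_union]
    ext v
    simp only [Set.mem_union, Set.mem_sdiff, hSa, hSb]
    tauto
  have h3 : ℙ[w] (rF[U', a, b] ∩ rD U' a ((S \ ↑Z ∪ Sa) ∩ (T \ ↑Z ∪ Sb))) ≤ Ψ₃ (rS U Z (α ∩ β)) :=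
    pr_mono hw0 hw1 (Set.inter_subset_inter_right _ (rD_antitone hsub3))
  have h4 : ℙ[w] (rE[U', o, R, ((S \ ↑Z ∪ Sa) ∪ (T \ ↑Z ∪ Sb))] ∩
      rD U' a ((S \ ↑Z ∪ Sa) ∪ (T \ ↑Z ∪ Sb))) = Ψ₄ (rS U Z (α ∪ β)) := by
    simp only [hΨ₄, hset4]
  have hIH' : Ψ₁ Sa * Ψ₂ Sb ≤ Ψ₃ (rS U Z (α ∩ β)) * Ψ₄ (rS U Z (α ∪ β)) := by
    rw [← h4]
    exact IH.trans (mul_le_mul_of_nonneg_right h3 (pr_nonneg hw0 hw1 _))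
  have hwab := weight_inter_mul_union w α β
  show weight w α * Ψ₁ Sa * (weight w β * Ψ₂ Sb) ≤
    weight w (α ∩ β) * Ψ₃ (rS U Z (α ∩ β)) * (weight w (α ∪ β) * Ψ₄ (rS U Z (α ∪ β)))
  calc weight w α * Ψ₁ Sa * (weight w β * Ψ₂ Sb)
      = (weight w α * weight w β) * (Ψ₁ Sa * Ψ₂ Sb) := by ring
    _ ≤ (weight w (α ∩ β) * weight w (α ∪ β)) * (Ψ₃ (rS U Z (α ∩ β)) * Ψ₄ (rS U Z (α ∪ β))) := by
        rw [hwab]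
        exact mul_le_mul_of_nonneg_left hIH'
          (mul_nonneg (weight_nonneg hw0 hw1 _) (weight_nonneg hw0 hw1 _))
    _ = _ := by ring

end Core

end Summit.CriticalPhenomena.PercolationContinuityZ3.Theorems.SandwichBHK

namespace Summit.CriticalPhenomena.PercolationContinuityZ3.Theorems

open Literature.Probability.LatticeModels Literature.Probability.Percolation
open scoped Classical

/-- **Registered stub `stub_sandwichCore_k18`** (siege k18, file 3/5): the sandwich induction `SandwichBHK.core` on `Fin n`, verbatim registered signature. [new] -/
theorem stub_sandwichCore_k18 :
    ∀ (n : ℕ) (w : Sym2 (Fin n) → ℝ), (∀ e, 0 ≤ w e) → (∀ e, w e ≤ 1) → ∑ ω, Literature.Probability.Percolation.BHK2006.weight w ω = 1 → ∀ (U : Finset (Fin n)) (o a b : Fin n), o ∈ U → a ∈ U → a ≠ b → ∀ (R : Set (Finset (Fin n))), (∀ W ∈ R, a ∉ W) → ∀ (S T : Set (Fin n)), S ⊆ ↑U → T ⊆ ↑U → (∑ ω, Literature.Probability.Percolation.BHK2006.weight w ω * Literature.Probability.Percolation.DecisionTree.ind ({ω : Set (Sym2 (Fin n)) | (openGraph (ω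 ∩ Literature.Probability.Percolation.BHK2006.edgesIn U)).Reachable a b} ∩ {ω : Set (Sym2 (Fin n)) | (∃ x ∈ S, (openGraph (ω ∩ Literature.Probability.Percolation.BHK2006.edgesIn U)).Reachable o x) ∨ (ω ∈ Literature.Probability.Percolation.BHK2006.rD U o S ∧ ∃ W ∈ R, ∀ v, v ∈ W ↔ (openGraph (ω ∩ Literature.Probability.Percolation.BHK2006.edgesIn U)).Reachable o v)} ∩ Literature.Probability.Percolation.BHK2006.rD U a S) ω) * (∑ ω, Literature.Probability.Percolation.BHK2006.weight w ω * Literature.Probability.Percolation.DecisionTree.ind (Literature.Probability.Percolation.BHK2006.rD U a T) ω) ≤ (∑ ω, Literature.Probability.Percolation.BHK2006.weight w ω * Literature.Probability.Percolation.DecisionTree.ind ({ω : Set (Sym2 (Fin n)) | (openGraph (ω ∩ Literature.Probability.Percolation.BHK2006.edgesIn U)).Reachable a b} ∩ Literature.Probability.Percolation.BHK2006.rD U a (S ∩ T)) ω) * (∑ ω, Literature.Probability.Percolation.BHK2006.weight w ω * Literature.Probability.Percolation.DecisionTree.ind ({ω : Set (Sym2 (Fin n)) | (∃ x ∈ (S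 ∪ T), (openGraph (ω ∩ Literature.Probability.Percolation.BHK2006.edgesIn U)).Reachable o x) ∨ (ω ∈ Literature.Probability.Percolation.BHK2006.rD U o (S ∪ T) ∧ ∃ W ∈ R, ∀ v, v ∈ W ↔ (openGraph (ω ∩ Literature.Probability.Percolation.BHK2006.edgesIn U)).Reachable o v)} ∩ Literature.Probability.Percolation.BHK2006.rD U a (S ∪ T)) ω) :=
  fun _ _ hw0 hw1 hm U o a b hoU haU hab R hR S T hSU hTU =>
    SandwichBHK.core hw0 hw1 hm U o a b hoU haU hab R hR S T hSU hTU

end Summit.CriticalPhenomena.PercolationContinuityZ3.Theorems
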